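import Literature.MathematicalPhysics.QuantumFieldTheory.Balaban1983to89.B8Prop5ContractionKLevel
import Literature.MathematicalPhysics.QuantumFieldTheory.Balaban1983to89.B8Eq1117Concrete
import Literature.MathematicalPhysics.QuantumFieldTheory.Balaban1983to89.B8Eq191FlatStencils
import Literature.MathematicalPhysics.QuantumFieldTheory.Balaban1983to89.B8Eq140Level

/-!
# `Balaban1983to89.B8Eq191FlatBoundsTransfer` — [Balaban1985RegularSpaces] (1.92) p. 91, (1.98) p. 92, (1.101) p. 93 AT `U₀ = 1`:
# «REAL KERNEL ⊗ id» — the five printed BOUNDS of the [4]-letters for `𝔤`-VALUED (here: `𝔸`-valued) lattice functions FOLLOW from the same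
# bounds for REAL lattice functions against the same real kernels

statement-level skeleton of published theorems with citation tags; proofs where landed; nothing here is a claim about the
Yang–Mills mass gap

`[Balaban1985RegularSpaces]` ("B8", CMP **99** (1985) 75–102): (1.91)–(1.92) p. 91 («|(H′X)(x)|, |(∇H′X)(x)| ≦ B′₀[1, (Lʲη)⁻¹]|X| for x ∈ Ω_j»),
p. 92 l. 2–4 («(H′X)(x) = Σ_{y′}(L^{j′}η)^d H′(x, y′)X(y′)»), (1.98) p. 92 («|Rf|₍₋₂₎ ≦ B_R|f|₍₋₂₎»), (1.101) p. 93 («|G′f|, |∇G′f| ≦ B_G|f|₍₋₂₎»), p. 93 l. 4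
(the `ΔH′` entry); [4] = `[Balaban1985BackgroundPropagators]` (CMP **99** (1985) 389–434) p. 394 («the operators act on functions with values in
the algebra … as `⊗ id`»; (3.23)–(3.25)), Thms 3.1–3.2 p. 397.

CITATION HEADER (lean-in-tree rule).  Cell `pub-ymgap` (YM Track A, HUMAN RULING D-0062), DAG node N05 = [B8], seat `pub-ymgap-dag-n05-e`
(g4; director-ym R141 (C), FAN-OUT §N05 row s3b — THE FLAT CURRENCY for Proposition 6; successor item (R2) of the seat's g3 HANDOFF).
`B8Eq191FlatLettersExplicit.exists_flatLetters_dirichlet_explicit` (g3) displays the [4]-letters at `U₀ = 1` on a finite Dirichlet region as REAL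
KERNELS tensored with the identity of `𝔸`: `(G′(1)f)(w) = Σ_z T⁻¹(w,z)•f(z)` (`w ∈ Ω₀`; `0` off `Ω₀`), `(H′Y)(w) = Σ_{p′} H(w,p′)•Y(p′)`,
`(G′QᵀCQG′f)(w) = Σ_z R(w,z)•f(z)`.  The consumer `B8SockHFPRD.sockHFP_body_of_join_RD` reads five BOUNDS on these letters —
`hG` ((1.101): `|G′f|`, weighted `|∇G′f|` against the `(−2)`-profile `Bd2`), `hH0 hH1 hH2` ((1.92) and the p. 93 `Δ`-entry, against the sup norm
of `X`), `hRbd` ((1.98), `Bd2 → Bd2` for `R = 1 − G′QᵀCQG′`) — for `𝔸`-VALUED fields.  THIS FILE proves, for ANY operators with such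
real-kernel representations (the kernels are free real matrices here; nothing of `T`, `Q` is used), that the five bounds for `𝔸`-valued
fields FOLLOW from the SAME five bounds for REAL lattice functions against the same kernels (`hG_flat_of_real`, `hH_flat_of_real`,
`hRbd_flat_of_real`).  Mechanism (our proof; print treats it as the convention «⊗ id», [4] p. 394): `‖Σ_z c_z•f(z)‖ ≤ Σ_z c_z·(sgn c_z·‖f(z)‖)`
(`norm_sum_smul_le_sum_mul_sign`) and the profiles `Bd2` ∕ `sup|X|` are blind to signs (`abs_sign_mul`), so the real test function
`ρ(z) := sgn(c_z)‖f(z)‖` has the profile of `f` and realises the majorant — for `ℓ^∞`-type weighted norms the real operator bound IS the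
majorant bound.  CONSEQUENCE: the residual of Proposition 6 in the flat currency becomes three families of SCALAR inequalities on explicit real
matrices — [4] Thms 3.1–3.2 at `U = 1` with Dirichlet conditions for REAL lattice functions, the currency in which the tree's flat multi-level
theorems (`B8Ineq192MultiLevelBox`, `B6Prop22AllMultiLevelBox`, …) are stated.

HONEST SCOPE.  Finite sums and the triangle inequality in a C⋆-algebra; NO estimate of [4] is proved — the real bounds are HYPOTHESES.
Count-neutral; N05 NOT discharged; one finite `T⁴` programme at fixed `ε`, Bałaban as printed; nothing continuum ∕ ℝ⁴ ∕ OS ∕ mass-gap ∕ Clay.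
No `sorry`, no `def`, no `instance`, no `notation`.  Unit `pub-ymgap-dag-n05-e` (g4), 2026-08-27.
-/

noncomputable section

namespace Literature.MathematicalPhysics.QuantumFieldTheory.Balaban1983to89.B8Eq191FlatBoundsTransfer

open B7Prop1Explicit (e)
open B8Ineq132 (covDerivFwd)
open B8Eq138LandauZd (covLap)
open B8Eq140Level (SideTouches)
open B8Eq1117Concrete (XSpace)
open B8Prop5ContractionKLevel (Bd2)
open B8LambdaSpaceKLevel (wt wt_nonneg)
open B8Eq191FlatStencils (covDerivFwd_flat_apply covLap_flat_apply)

-- `Site` alone could resolve to the torus sites of `Setup.lean`; re-export the `ℤ^d` sites of `B7Prop1Explicit`.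
export B7Prop1Explicit (Site)

variable {d : ℕ}

/-! ## §0 The sign trick: a real linear combination of vectors is majorised by the real combination of the signed norms -/

section Sign

variable {𝔸 : Type*} [CStarAlgebra 𝔸]

/-- `|sgn(c)·t| = t` for `t ≥ 0` (`sgn c = ±1`): the signed test function has the same profile as the norm function. [folklore]
[cite: Balaban1985BackgroundPropagators, p.394 («⊗ id»)] -/
theorem abs_sign_mul (c : ℝ) {t : ℝ} (ht : 0 ≤ t) : |(if 0 ≤ c then (1 : ℝ) else -1) * t| = t := by
  split_ifs with h
  · rw [one_mul, abs_of_nonneg ht]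
  · rw [neg_one_mul, abs_neg, abs_of_nonneg ht]

/-- `c·(sgn(c)·t) = |c|·t`. [folklore] [cite: Balaban1985BackgroundPropagators, p.394 («⊗ id»)] -/
theorem mul_sign_mul (c t : ℝ) : c * ((if 0 ≤ c then (1 : ℝ) else -1) * t) = |c| * t := by
  split_ifs with h
  · rw [one_mul, abs_of_nonneg h]
  · rw [abs_of_neg (lt_of_not_ge h)]; ring

/-- **THE SIGN TRICK** «real kernel ⊗ id»: for real coefficients `c_i` and vectors `v_i` of a C⋆-algebra,
`‖Σ_i c_i•v_i‖ ≤ Σ_i c_i·(sgn(c_i)·‖v_i‖)` (`= Σ_i|c_i|‖v_i‖`) — the real row applied to the SIGNED norm function majorises the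
vector-valued row. (our proof; print: the operators act as `⊗ id`) [cite: Balaban1985BackgroundPropagators, p.394; Balaban1985RegularSpaces, p.92 (display of (H′X)(x))] -/
theorem norm_sum_smul_le_sum_mul_sign {ι : Type*} (s : Finset ι) (c : ι → ℝ) (v : ι → 𝔸) :
    ‖∑ i ∈ s, c i • v i‖ ≤ ∑ i ∈ s, c i * ((if 0 ≤ c i then (1 : ℝ) else -1) * ‖v i‖) := by
  refine (norm_sum_le _ _).trans (Finset.sum_le_sum fun i _ => ?_)
  rw [mul_sign_mul, ← Complex.coe_smul, norm_smul, Complex.norm_real, Real.norm_eq_abs]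

/-- The second-difference stencil commutes with a real-kernel representation: for `F(y) = Σ_i K(y,i)•v_i`,
`Σ_μ η⁻²(2F(x) − F(x + e_μ) − F(x − e_μ)) = Σ_i [Σ_μ η⁻²(2K(x,i) − K(x + e_μ,i) − K(x − e_μ,i))]•v_i` (any real module).
[folklore] [cite: Balaban1985BackgroundPropagators, (3.23) p.394; Balaban1985RegularSpaces, p.93 l.4] -/
theorem stencil_sum_smul {ι V : Type*} [Fintype ι] [AddCommGroup V] [Module ℝ V] (K : Site d → ι → ℝ) (v : ι → V)
    (η : ℝ) (x : Site d) :
    ∑ μ : Fin d, (η ^ 2)⁻¹ • ((2 : ℝ) • (∑ i, K x i • v i) - (∑ i, K (x + e μ) i • v i) - (∑ i, K (x - e μ) i • v i)) =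
      ∑ i, (∑ μ : Fin d, (η ^ 2)⁻¹ * (2 * K x i - K (x + e μ) i - K (x - e μ) i)) • v i := by
  have hin : ∀ μ : Fin d, (2 : ℝ) • (∑ i, K x i • v i) - (∑ i, K (x + e μ) i • v i) - (∑ i, K (x - e μ) i • v i) =
      ∑ i, (2 * K x i - K (x + e μ) i - K (x - e μ) i) • v i := by
    intro μ
    rw [Finset.smul_sum, ← Finset.sum_sub_distrib, ← Finset.sum_sub_distrib]
    exact Finset.sum_congr rfl fun i _ => by rw [sub_smul, sub_smul, smul_smul]
  simp_rw [hin, Finset.smul_sum, smul_smul]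
  rw [Finset.sum_comm]
  exact Finset.sum_congr rfl fun i _ => by rw [← Finset.sum_smul]

end Sign

/-! ## §1 (1.101) for `G′(1) = T⁻¹ ⊗ id`: the `𝔸`-valued bound from the real bound -/

section Gprime

variable {𝔸 : Type*} [CStarAlgebra 𝔸]

/-- **(1.101) AT `U₀ = 1` FOR `𝔸`-VALUED FIELDS FROM (1.101) FOR REAL FIELDS** («|G′(1)f|, |∇^η G′(1)f| ≦ B_G|f|₍₋₂₎», [4] Thm 3.1 shape).
SETTING: levels `≤ n`, spacing `η > 0`, regions `Ω_j`, the Dirichlet region `Ω₀ = Ω 0` listed by a `Finset` `S`; an operator `g` with a REAL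
KERNEL on `Ω₀`: `(gf)(w) = Σ_{z∈Ω₀} G(w,z)•f(z)` for `w ∈ Ω₀` and `gf = 0` off `Ω₀` (the shape displayed by
`B8Eq191FlatLettersExplicit.exists_flatLetters_dirichlet_explicit` for `G′(1) = T⁻¹ ⊗ id`).  HYPOTHESIS `hGs` = (1.101) FOR REAL TEST
FUNCTIONS: for every real `ρ` on `Ω₀` with the `(−2)`-profile `(Lʲη)²|ρ| ≤ r` on `Ω_j` (`j ≤ n`) and the real field `φ = Gρ` (`φ(w) = Σ_z G(w,z)ρ(z)`
on `Ω₀`, `0` off `Ω₀`): `|φ| ≤ B_G·r` everywhere and `(Lʲη)|η⁻¹(φ(x + e_μ) − φ(x))| ≤ B_G·r` on the sides of the plaquettes touching `Ω_j`.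
CONCLUSION = VERBATIM the binder `hG` of `B8SockHFPRD.sockHFP_body_of_join_RD` at `U₀ := 1`: for every `𝔸`-valued `f` with `Bd2 L η n Ω f r`,
`‖gf‖ ≤ B_G·r` and `(Lʲη)‖D^η_{1,μ}(gf)‖ ≤ B_G·r` on the same bonds.  PROOF: the sign trick (`norm_sum_smul_le_sum_mul_sign`) with
`ρ := sgn(G(x,·))‖f‖`, resp. `sgn(G(x + e_μ,·) − G(x,·))‖f‖`, whose profile is that of `f` (`abs_sign_mul`).
[cite: Balaban1985RegularSpaces, (1.101) p.93; Balaban1985BackgroundPropagators, Thm 3.1 p.397, p.394 («⊗ id»)] -/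
theorem hG_flat_of_real (L : ℕ) {η : ℝ} (hη : 0 < η) (n : ℕ) (Ω : ℕ → Set (Site d))
    (S : Finset (Site d)) (hS : ∀ w, w ∈ S ↔ w ∈ Ω 0)
    (g : (Site d → 𝔸) →ₗ[ℂ] (Site d → 𝔸)) (G : Matrix ↥S ↥S ℝ)
    (hgker : ∀ (f : Site d → 𝔸) (w : ↥S), g f w.1 = ∑ z : ↥S, G w z • f z.1)
    (hGsupp : ∀ (f : Site d → 𝔸) (x : Site d), x ∉ Ω 0 → g f x = 0)
    {BG : ℝ}
    (hGs : ∀ (ρ : ↥S → ℝ) (r : ℝ), 0 ≤ r → (∀ j, j ≤ n → ∀ z : ↥S, z.1 ∈ Ω j → wt L η j ^ 2 * |ρ z| ≤ r) →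
      ∀ φ : Site d → ℝ, (∀ x, x ∉ Ω 0 → φ x = 0) → (∀ w : ↥S, φ w.1 = ∑ z : ↥S, G w z * ρ z) →
      (∀ x, |φ x| ≤ BG * r) ∧
      ∀ j, j ≤ n → ∀ p ∈ {b : Site d × Fin d | SideTouches (Ω j) b.1 b.2},
        wt L η j * |η⁻¹ * (φ (p.1 + e p.2) - φ p.1)| ≤ BG * r) :
    ∀ (f : Site d → 𝔸) (r : ℝ), 0 ≤ r → Bd2 L η n Ω f r →
      (∀ x, ‖g f x‖ ≤ BG * r) ∧ ∀ j, j ≤ n → ∀ p ∈ {b : Site d × Fin d | SideTouches (Ω j) b.1 b.2},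
        wt L η j * ‖covDerivFwd η (1 : Site d → Fin d → 𝔸ˣ) p.2 (g f) p.1‖ ≤ BG * r := by
  classical
  intro f r hr hf
  -- the zero-extended kernel and the kernel form of `gf` at every site
  obtain ⟨Gh, hGh⟩ : ∃ Gh : Site d → ↥S → ℝ, Gh = fun y z => if hy : y ∈ S then G ⟨y, hy⟩ z else 0 := ⟨_, rfl⟩
  have hGh_mem' : ∀ (y : Site d) (hy : y ∈ S) (z : ↥S), Gh y z = G ⟨y, hy⟩ z := fun y hy z => by
    rw [hGh]; simp only [dif_pos hy]
  have hGh_mem : ∀ (w : ↥S) (z : ↥S), Gh w.1 z = G w z := fun w z => hGh_mem' w.1 w.2 z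
  have hGh_off : ∀ y, y ∉ S → ∀ z, Gh y z = 0 := fun y hy z => by rw [hGh]; simp only [dif_neg hy]
  have hgf : ∀ y, g f y = ∑ z : ↥S, Gh y z • f z.1 := by
    intro y
    by_cases hy : y ∈ S
    · rw [show g f y = g f (⟨y, hy⟩ : ↥S).1 from rfl, hgker]
      exact Finset.sum_congr rfl fun z _ => by rw [hGh_mem' y hy]
    · rw [hGsupp f y (fun h => hy ((hS y).mpr h))]
      exact (Finset.sum_eq_zero fun z _ => by rw [hGh_off y hy, zero_smul]).symm
  -- the signed test function of a coefficient row has the profile of `f`; its field is `Σ_z Gh(·,z)ρ(z)`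
  have hprof : ∀ (c : ↥S → ℝ) (j : ℕ), j ≤ n → ∀ z : ↥S, z.1 ∈ Ω j →
      wt L η j ^ 2 * |(if 0 ≤ c z then (1 : ℝ) else -1) * ‖f z.1‖| ≤ r := by
    intro c j hj z hz
    rw [abs_sign_mul _ (norm_nonneg _)]
    exact hf j hj z.1 hz
  have hφoff : ∀ (ρ : ↥S → ℝ) (x : Site d), x ∉ Ω 0 → (fun y => ∑ z : ↥S, Gh y z * ρ z) x = 0 := by
    intro ρ x hx
    exact Finset.sum_eq_zero fun z _ => by rw [hGh_off x (fun h => hx ((hS x).mp h)), zero_mul]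
  have hφon : ∀ (ρ : ↥S → ℝ) (w : ↥S), (fun y => ∑ z : ↥S, Gh y z * ρ z) w.1 = ∑ z : ↥S, G w z * ρ z := by
    intro ρ w
    exact Finset.sum_congr rfl fun z _ => by rw [hGh_mem]
  refine ⟨fun x => ?_, fun j hj p hp => ?_⟩
  · -- `|G′f(x)| ≤ B_G r`
    obtain ⟨ρ, hρ⟩ : ∃ ρ : ↥S → ℝ, ρ = fun z => (if 0 ≤ Gh x z then (1 : ℝ) else -1) * ‖f z.1‖ := ⟨_, rfl⟩
    obtain ⟨h1, -⟩ := hGs ρ r hr (fun j hj z hz => by rw [hρ]; exact hprof _ j hj z hz) _ (hφoff ρ) (hφon ρ)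
    calc ‖g f x‖ = ‖∑ z : ↥S, Gh x z • f z.1‖ := by rw [hgf]
      _ ≤ ∑ z : ↥S, Gh x z * ((if 0 ≤ Gh x z then (1 : ℝ) else -1) * ‖f z.1‖) := norm_sum_smul_le_sum_mul_sign _ _ _
      _ = ∑ z : ↥S, Gh x z * ρ z := by rw [hρ]
      _ ≤ |∑ z : ↥S, Gh x z * ρ z| := le_abs_self _
      _ ≤ BG * r := h1 x
  · -- `(Lʲη)|∇G′f| ≤ B_G r` on the sides touching `Ω_j`
    obtain ⟨c, hc⟩ : ∃ c : ↥S → ℝ, c = fun z => Gh (p.1 + e p.2) z - Gh p.1 z := ⟨_, rfl⟩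
    obtain ⟨ρ, hρ⟩ : ∃ ρ : ↥S → ℝ, ρ = fun z => (if 0 ≤ c z then (1 : ℝ) else -1) * ‖f z.1‖ := ⟨_, rfl⟩
    obtain ⟨-, h2⟩ := hGs ρ r hr (fun j hj z hz => by rw [hρ]; exact hprof _ j hj z hz) _ (hφoff ρ) (hφon ρ)
    have h2p := h2 j hj p hp
    have hD : g f (p.1 + e p.2) - g f p.1 = ∑ z : ↥S, c z • f z.1 := by
      rw [hgf, hgf, ← Finset.sum_sub_distrib]
      exact Finset.sum_congr rfl fun z _ => by rw [hc, sub_smul]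
    have hφD : (∑ z : ↥S, Gh (p.1 + e p.2) z * ρ z) - (∑ z : ↥S, Gh p.1 z * ρ z) = ∑ z : ↥S, c z * ρ z := by
      rw [← Finset.sum_sub_distrib]
      exact Finset.sum_congr rfl fun z _ => by rw [hc, sub_mul]
    have hw0 : 0 ≤ wt L η j := wt_nonneg L hη.le j
    have hη0 : 0 ≤ η⁻¹ := inv_nonneg.mpr hη.le
    have hmaj : ‖∑ z : ↥S, c z • f z.1‖ ≤ ∑ z : ↥S, c z * ρ z := by
      rw [hρ]; exact norm_sum_smul_le_sum_mul_sign _ _ _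
    calc wt L η j * ‖covDerivFwd η (1 : Site d → Fin d → 𝔸ˣ) p.2 (g f) p.1‖
        = wt L η j * (η⁻¹ * ‖∑ z : ↥S, c z • f z.1‖) := by
          rw [covDerivFwd_flat_apply, ← Complex.coe_smul, norm_smul, Complex.norm_real, Real.norm_eq_abs,
            abs_of_nonneg hη0, hD]
      _ ≤ wt L η j * (η⁻¹ * ∑ z : ↥S, c z * ρ z) := by gcongr
      _ ≤ wt L η j * |η⁻¹ * ((∑ z : ↥S, Gh (p.1 + e p.2) z * ρ z) - (∑ z : ↥S, Gh p.1 z * ρ z))| := by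
          rw [hφD]; exact mul_le_mul_of_nonneg_left (le_abs_self _) hw0
      _ ≤ BG * r := h2p

end Gprime

/-! ## §2 (1.92) and the p. 93 `Δ`-entry for `H′ ⊗ id`: the `𝔸`-valued bounds from the real bounds -/

section Hprime

variable {𝔸 : Type*} [CStarAlgebra 𝔸]

/-- **(1.92) + THE p. 93 `ΔH′`-ENTRY AT `U₀ = 1` FOR `𝔸`-VALUED `X` FROM THE SAME FOR REAL `X`** («|(H′X)(x)|, |(∇H′X)(x)| ≦ B′₀[1, (Lʲη)⁻¹]|X|
for x ∈ Ω_j»).  SETTING: levels `≤ n`, spacing `η > 0`, regions `Ω_j`, structure `Λ_j`, `Ω₀ = Ω 0` listed by `S`, the tower index set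
`𝔅 = {(j, y) ∣ j ≤ n, y ∈ Λ_j}` listed by `B`; an operator `H′` on the `X`-space with a REAL KERNEL: `(H′Y)(w) = Σ_{p′∈𝔅} H(w,p′)•Y(p′)` on `Ω₀`,
`0` off `Ω₀` (the shape displayed for `H′ = T⁻²Qᵀ(QT⁻²Qᵀ)⁻¹ ⊗ id`).  HYPOTHESIS `hHs` = the three bounds FOR REAL `X : 𝔅 → ℝ` with `|X| ≤ s`
and the real field `φ = HX` (`φ(w) = Σ_{p′} H(w,p′)X(p′)` on `Ω₀`, `0` off): `|φ| ≤ B′₀s` everywhere, `(Lʲη)|η⁻¹(φ(x + e_μ) − φ(x))| ≤ B′₀s` on the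
sides touching `Ω_j`, `(Lʲη)²|Σ_μ η⁻²(2φ(x) − φ(x + e_μ) − φ(x − e_μ))| ≤ B₂′s` on `Ω_j`.  CONCLUSION = VERBATIM the binders `hH0 hH1 hH2` of
`B8SockHFPRD.sockHFP_body_of_join_RD` at `U₀ := 1` (levels `n`): `‖H′X(x)‖ ≤ B′₀‖X‖`, `(Lʲη)‖D^η_{1,μ}(H′X)‖ ≤ B′₀‖X‖` on the sides touching
`Ω_j`, `Bd2 L η n Ω (Δ^η_1(H′X)) (B₂′‖X‖)`.  PROOF: sign trick with `X(p′) := sgn(·)‖Y(p′)‖ ≤ ‖Y‖`; the `Δ`-stencil commutes with the kernel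
(`stencil_sum_smul`, `covLap_flat_apply`).
[cite: Balaban1985RegularSpaces, (1.91)–(1.92) p.91, p.92 l.2–4, p.93 l.4; Balaban1985BackgroundPropagators, Thm 3.2 p.397, p.394 («⊗ id»)] -/
theorem hH_flat_of_real (L : ℕ) {η : ℝ} (hη : 0 < η) (n : ℕ) (Ω : ℕ → Set (Site d)) (Λs : ℕ → Set (Site d))
    (S : Finset (Site d)) (hS : ∀ w, w ∈ S ↔ w ∈ Ω 0)
    (B : Finset (ℕ × Site d)) (hB : ∀ p, p ∈ B ↔ p.1 ≤ n ∧ p.2 ∈ Λs p.1)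
    (H' : XSpace d n 𝔸 →ₗ[ℂ] (Site d → 𝔸)) (H : Matrix ↥S ↥B ℝ)
    (hHker : ∀ (Y : XSpace d n 𝔸) (w : ↥S),
      H' Y w.1 = ∑ p' : ↥B, H w p' • Y (⟨p'.1.1, Nat.lt_succ_of_le ((hB p'.1).mp p'.2).1⟩, p'.1.2))
    (hHsupp : ∀ (Y : XSpace d n 𝔸) (x : Site d), x ∉ Ω 0 → H' Y x = 0)
    {B₀'H B₂' : ℝ}
    (hHs : ∀ (X : ↥B → ℝ) (s : ℝ), 0 ≤ s → (∀ p', |X p'| ≤ s) →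
      ∀ φ : Site d → ℝ, (∀ x, x ∉ Ω 0 → φ x = 0) → (∀ w : ↥S, φ w.1 = ∑ p' : ↥B, H w p' * X p') →
      (∀ x, |φ x| ≤ B₀'H * s) ∧
      (∀ j, j ≤ n → ∀ p ∈ {b : Site d × Fin d | SideTouches (Ω j) b.1 b.2},
        wt L η j * |η⁻¹ * (φ (p.1 + e p.2) - φ p.1)| ≤ B₀'H * s) ∧
      (∀ j, j ≤ n → ∀ x ∈ Ω j,
        wt L η j ^ 2 * |∑ μ : Fin d, (η ^ 2)⁻¹ * (2 * φ x - φ (x + e μ) - φ (x - e μ))| ≤ B₂' * s)) :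
    (∀ (X : XSpace d n 𝔸) (x : Site d), ‖H' X x‖ ≤ B₀'H * ‖X‖) ∧
    (∀ j, j ≤ n → ∀ (X : XSpace d n 𝔸), ∀ p ∈ {b : Site d × Fin d | SideTouches (Ω j) b.1 b.2},
      wt L η j * ‖covDerivFwd η (1 : Site d → Fin d → 𝔸ˣ) p.2 (H' X) p.1‖ ≤ B₀'H * ‖X‖) ∧
    (∀ X : XSpace d n 𝔸, Bd2 L η n Ω (covLap η (1 : Site d → Fin d → 𝔸ˣ) (H' X)) (B₂' * ‖X‖)) := by
  classical
  -- the zero-extended kernel and the kernel form of `H′Y` at every site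
  obtain ⟨Hh, hHh⟩ : ∃ Hh : Site d → ↥B → ℝ, Hh = fun y p' => if hy : y ∈ S then H ⟨y, hy⟩ p' else 0 := ⟨_, rfl⟩
  have hHh_mem' : ∀ (y : Site d) (hy : y ∈ S) (p' : ↥B), Hh y p' = H ⟨y, hy⟩ p' := fun y hy p' => by
    rw [hHh]; simp only [dif_pos hy]
  have hHh_mem : ∀ (w : ↥S) (p' : ↥B), Hh w.1 p' = H w p' := fun w p' => hHh_mem' w.1 w.2 p'
  have hHh_off : ∀ y, y ∉ S → ∀ p', Hh y p' = 0 := fun y hy p' => by rw [hHh]; simp only [dif_neg hy]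
  -- the values of `Y` on `𝔅` and their size
  have hval : ∀ (Y : XSpace d n 𝔸), ∃ v : ↥B → 𝔸, (∀ p' : ↥B, v p' = Y (⟨p'.1.1, Nat.lt_succ_of_le ((hB p'.1).mp p'.2).1⟩, p'.1.2)) ∧
      ∀ p', ‖v p'‖ ≤ ‖Y‖ := fun Y => ⟨_, fun p' => rfl, fun p' => BoundedContinuousFunction.norm_coe_le_norm Y _⟩
  have hHY : ∀ (Y : XSpace d n 𝔸) (v : ↥B → 𝔸), (∀ p' : ↥B, v p' = Y (⟨p'.1.1, Nat.lt_succ_of_le ((hB p'.1).mp p'.2).1⟩, p'.1.2)) →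
      ∀ y, H' Y y = ∑ p' : ↥B, Hh y p' • v p' := by
    intro Y v hv y
    by_cases hy : y ∈ S
    · rw [show H' Y y = H' Y (⟨y, hy⟩ : ↥S).1 from rfl, hHker]
      exact Finset.sum_congr rfl fun p' _ => by rw [hHh_mem' y hy, hv]
    · rw [hHsupp Y y (fun h => hy ((hS y).mpr h))]
      exact (Finset.sum_eq_zero fun p' _ => by rw [hHh_off y hy, zero_smul]).symm
  -- the signed test function of a coefficient row is bounded by `‖Y‖`; its field is `Σ_{p′} Hh(·,p′)X(p′)`
  have hprof : ∀ (Y : XSpace d n 𝔸) (v : ↥B → 𝔸), (∀ p', ‖v p'‖ ≤ ‖Y‖) → ∀ (c : ↥B → ℝ) (p' : ↥B),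
      |(if 0 ≤ c p' then (1 : ℝ) else -1) * ‖v p'‖| ≤ ‖Y‖ := by
    intro Y v hv c p'
    rw [abs_sign_mul _ (norm_nonneg _)]
    exact hv p'
  have hφoff : ∀ (X : ↥B → ℝ) (x : Site d), x ∉ Ω 0 → (fun y => ∑ p' : ↥B, Hh y p' * X p') x = 0 := by
    intro X x hx
    exact Finset.sum_eq_zero fun p' _ => by rw [hHh_off x (fun h => hx ((hS x).mp h)), zero_mul]
  have hφon : ∀ (X : ↥B → ℝ) (w : ↥S), (fun y => ∑ p' : ↥B, Hh y p' * X p') w.1 = ∑ p' : ↥B, H w p' * X p' := by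
    intro X w
    exact Finset.sum_congr rfl fun p' _ => by rw [hHh_mem]
  have hη0 : 0 ≤ η⁻¹ := inv_nonneg.mpr hη.le
  refine ⟨fun Y x => ?_, fun j hj Y p hp => ?_, fun Y j hj x hx => ?_⟩
  · -- `|H′Y(x)| ≤ B′₀‖Y‖`
    obtain ⟨v, hv, hvn⟩ := hval Y
    obtain ⟨X, hX⟩ : ∃ X : ↥B → ℝ, X = fun p' => (if 0 ≤ Hh x p' then (1 : ℝ) else -1) * ‖v p'‖ := ⟨_, rfl⟩
    obtain ⟨h1, -, -⟩ := hHs X ‖Y‖ (norm_nonneg _) (fun p' => by rw [hX]; exact hprof Y v hvn _ p') _ (hφoff X) (hφon X)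
    calc ‖H' Y x‖ = ‖∑ p' : ↥B, Hh x p' • v p'‖ := by rw [hHY Y v hv]
      _ ≤ ∑ p' : ↥B, Hh x p' * ((if 0 ≤ Hh x p' then (1 : ℝ) else -1) * ‖v p'‖) := norm_sum_smul_le_sum_mul_sign _ _ _
      _ = ∑ p' : ↥B, Hh x p' * X p' := by rw [hX]
      _ ≤ |∑ p' : ↥B, Hh x p' * X p'| := le_abs_self _
      _ ≤ B₀'H * ‖Y‖ := h1 x
  · -- `(Lʲη)|∇H′Y| ≤ B′₀‖Y‖` on the sides touching `Ω_j`
    obtain ⟨v, hv, hvn⟩ := hval Y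
    obtain ⟨c, hc⟩ : ∃ c : ↥B → ℝ, c = fun p' => Hh (p.1 + e p.2) p' - Hh p.1 p' := ⟨_, rfl⟩
    obtain ⟨X, hX⟩ : ∃ X : ↥B → ℝ, X = fun p' => (if 0 ≤ c p' then (1 : ℝ) else -1) * ‖v p'‖ := ⟨_, rfl⟩
    obtain ⟨-, h2, -⟩ := hHs X ‖Y‖ (norm_nonneg _) (fun p' => by rw [hX]; exact hprof Y v hvn _ p') _ (hφoff X) (hφon X)
    have h2p := h2 j hj p hp
    have hD : H' Y (p.1 + e p.2) - H' Y p.1 = ∑ p' : ↥B, c p' • v p' := by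
      rw [hHY Y v hv, hHY Y v hv, ← Finset.sum_sub_distrib]
      exact Finset.sum_congr rfl fun p' _ => by rw [hc, sub_smul]
    have hφD : (∑ p' : ↥B, Hh (p.1 + e p.2) p' * X p') - (∑ p' : ↥B, Hh p.1 p' * X p') = ∑ p' : ↥B, c p' * X p' := by
      rw [← Finset.sum_sub_distrib]
      exact Finset.sum_congr rfl fun p' _ => by rw [hc, sub_mul]
    have hw0 : 0 ≤ wt L η j := wt_nonneg L hη.le j
    have hmaj : ‖∑ p' : ↥B, c p' • v p'‖ ≤ ∑ p' : ↥B, c p' * X p' := by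
      rw [hX]; exact norm_sum_smul_le_sum_mul_sign _ _ _
    calc wt L η j * ‖covDerivFwd η (1 : Site d → Fin d → 𝔸ˣ) p.2 (H' Y) p.1‖
        = wt L η j * (η⁻¹ * ‖∑ p' : ↥B, c p' • v p'‖) := by
          rw [covDerivFwd_flat_apply, ← Complex.coe_smul, norm_smul, Complex.norm_real, Real.norm_eq_abs,
            abs_of_nonneg hη0, hD]
      _ ≤ wt L η j * (η⁻¹ * ∑ p' : ↥B, c p' * X p') := by gcongr
      _ ≤ wt L η j * |η⁻¹ * ((∑ p' : ↥B, Hh (p.1 + e p.2) p' * X p') - (∑ p' : ↥B, Hh p.1 p' * X p'))| := by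
          rw [hφD]; exact mul_le_mul_of_nonneg_left (le_abs_self _) hw0
      _ ≤ B₀'H * ‖Y‖ := h2p
  · -- the `Δ`-entry: `(Lʲη)²|Δ^η_1(H′Y)(x)| ≤ B₂′‖Y‖` on `Ω_j`
    obtain ⟨v, hv, hvn⟩ := hval Y
    obtain ⟨c, hc⟩ : ∃ c : ↥B → ℝ, c = fun p' => ∑ μ : Fin d, (η ^ 2)⁻¹ * (2 * Hh x p' - Hh (x + e μ) p' - Hh (x - e μ) p') :=
      ⟨_, rfl⟩
    obtain ⟨X, hX⟩ : ∃ X : ↥B → ℝ, X = fun p' => (if 0 ≤ c p' then (1 : ℝ) else -1) * ‖v p'‖ := ⟨_, rfl⟩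
    obtain ⟨-, -, h3⟩ := hHs X ‖Y‖ (norm_nonneg _) (fun p' => by rw [hX]; exact hprof Y v hvn _ p') _ (hφoff X) (hφon X)
    have h3x := h3 j hj x hx
    -- the Laplacian of `H′Y` in kernel form
    have hLap : covLap η (1 : Site d → Fin d → 𝔸ˣ) (H' Y) x = ∑ p' : ↥B, c p' • v p' := by
      rw [covLap_flat_apply]
      have hF : (H' Y : Site d → 𝔸) = fun y => ∑ p' : ↥B, Hh y p' • v p' := funext (hHY Y v hv)
      rw [hF, stencil_sum_smul, hc]
    -- the same for the real field
    have hLapφ : ∑ μ : Fin d, (η ^ 2)⁻¹ * (2 * (∑ p' : ↥B, Hh x p' * X p') - (∑ p' : ↥B, Hh (x + e μ) p' * X p') -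
        (∑ p' : ↥B, Hh (x - e μ) p' * X p')) = ∑ p' : ↥B, c p' * X p' := by
      have h := stencil_sum_smul (V := ℝ) Hh X η x
      simp only [smul_eq_mul] at h
      rw [h, hc]
    have hw0 : 0 ≤ wt L η j ^ 2 := sq_nonneg _
    have hmaj : ‖∑ p' : ↥B, c p' • v p'‖ ≤ ∑ p' : ↥B, c p' * X p' := by
      rw [hX]; exact norm_sum_smul_le_sum_mul_sign _ _ _
    calc wt L η j ^ 2 * ‖covLap η (1 : Site d → Fin d → 𝔸ˣ) (H' Y) x‖
        = wt L η j ^ 2 * ‖∑ p' : ↥B, c p' • v p'‖ := by rw [hLap]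
      _ ≤ wt L η j ^ 2 * ∑ p' : ↥B, c p' * X p' := mul_le_mul_of_nonneg_left hmaj hw0
      _ ≤ wt L η j ^ 2 * |∑ μ : Fin d, (η ^ 2)⁻¹ * (2 * (∑ p' : ↥B, Hh x p' * X p') - (∑ p' : ↥B, Hh (x + e μ) p' * X p') -
          (∑ p' : ↥B, Hh (x - e μ) p' * X p'))| := by
          rw [hLapφ]; exact mul_le_mul_of_nonneg_left (le_abs_self _) hw0
      _ ≤ B₂' * ‖Y‖ := h3x

end Hprime

/-! ## §3 (1.98) for `R = 1 − G′QᵀCQG′`: the `𝔸`-valued `Bd2 → Bd2` bound from the real bound -/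

section Rop

variable {𝔸 : Type*} [CStarAlgebra 𝔸]

/-- **(1.98) AT `U₀ = 1` FOR `𝔸`-VALUED FIELDS FROM (1.98) FOR REAL FIELDS** («|Rf|₍₋₂₎ ≦ B_R|f|₍₋₂₎», `R = 1 − G′QᵀCQG′`).  SETTING: levels
`≤ n`, spacing `η`, regions `Ω_j ⊆ Ω₀ = Ω 0` (`j ≤ n`), `Ω₀` listed by `S`; a map `P` (standing for `f ↦ G′QᵀCQG′f`) with a REAL KERNEL
on `Ω₀`: `(Pf)(w) = Σ_{z∈Ω₀} K(w,z)•f(z)` for `w ∈ Ω₀` (the shape of `T⁻¹Qᵀ(QT⁻²Qᵀ)⁻¹QT⁻¹ ⊗ id`).  HYPOTHESIS `hRs` = (1.98) FOR REAL TEST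
FUNCTIONS: for every real `ρ` on `Ω₀` with the `(−2)`-profile `≤ r`: `(Lʲη)²|ρ(w) − Σ_z K(w,z)ρ(z)| ≤ B_R·r` for `w ∈ Ω_j`, `j ≤ n`.
CONCLUSION = VERBATIM the binder `hRbd` of `B8SockHFPRD.sockHFP_body_of_join_RD` at `U₀ := 1`: `Bd2 L η n Ω f r → Bd2 L η n Ω (f − Pf) (B_R·r)`.
PROOF: sign trick with `ρ := sgn(δ_w − K(w,·))‖f‖`.
[cite: Balaban1985RegularSpaces, (1.97)–(1.98) p.92; Balaban1985BackgroundPropagators, (3.25) p.394, Thm 3.2 p.397, p.394 («⊗ id»)] -/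
theorem hRbd_flat_of_real (L : ℕ) {η : ℝ} (n : ℕ) (Ω : ℕ → Set (Site d)) (hΩ0 : ∀ j, j ≤ n → Ω j ⊆ Ω 0)
    (S : Finset (Site d)) (hS : ∀ w, w ∈ S ↔ w ∈ Ω 0)
    (P : (Site d → 𝔸) → (Site d → 𝔸)) (K : Matrix ↥S ↥S ℝ)
    (hPker : ∀ (f : Site d → 𝔸) (w : ↥S), P f w.1 = ∑ z : ↥S, K w z • f z.1)
    {BR : ℝ}
    (hRs : ∀ (ρ : ↥S → ℝ) (r : ℝ), 0 ≤ r → (∀ j, j ≤ n → ∀ z : ↥S, z.1 ∈ Ω j → wt L η j ^ 2 * |ρ z| ≤ r) →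
      ∀ j, j ≤ n → ∀ w : ↥S, w.1 ∈ Ω j → wt L η j ^ 2 * |ρ w - ∑ z : ↥S, K w z * ρ z| ≤ BR * r) :
    ∀ (f : Site d → 𝔸) (r : ℝ), 0 ≤ r → Bd2 L η n Ω f r → Bd2 L η n Ω (f - P f) (BR * r) := by
  classical
  intro f r hr hf j hj x hx
  have hxS : x ∈ S := (hS x).mpr (hΩ0 j hj hx)
  -- `(f − Pf)(x) = Σ_z (δ_{xz} − K(x,z))•f(z)`
  obtain ⟨c, hc⟩ : ∃ c : ↥S → ℝ, c = fun z => (if z = ⟨x, hxS⟩ then (1 : ℝ) else 0) - K ⟨x, hxS⟩ z := ⟨_, rfl⟩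
  have hδ : ∑ z : ↥S, (if z = ⟨x, hxS⟩ then (1 : ℝ) else 0) • f z.1 = f x := by
    simp only [ite_smul, one_smul, zero_smul, Finset.sum_ite_eq', Finset.mem_univ, if_true]
  have hD : (f - P f) x = ∑ z : ↥S, c z • f z.1 := by
    rw [Pi.sub_apply, show P f x = P f (⟨x, hxS⟩ : ↥S).1 from rfl, hPker, ← hδ, ← Finset.sum_sub_distrib]
    exact Finset.sum_congr rfl fun z _ => by rw [hc, sub_smul]
  -- the signed test function
  obtain ⟨ρ, hρ⟩ : ∃ ρ : ↥S → ℝ, ρ = fun z => (if 0 ≤ c z then (1 : ℝ) else -1) * ‖f z.1‖ := ⟨_, rfl⟩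
  have hprofρ : ∀ j', j' ≤ n → ∀ z : ↥S, z.1 ∈ Ω j' → wt L η j' ^ 2 * |ρ z| ≤ r := by
    intro j' hj' z hz
    rw [hρ, abs_sign_mul _ (norm_nonneg _)]
    exact hf j' hj' z.1 hz
  have h := hRs ρ r hr hprofρ j hj ⟨x, hxS⟩ hx
  have hδρ : ∑ z : ↥S, (if z = ⟨x, hxS⟩ then (1 : ℝ) else 0) * ρ z = ρ ⟨x, hxS⟩ := by
    simp only [ite_mul, one_mul, zero_mul, Finset.sum_ite_eq', Finset.mem_univ, if_true]
  have hφD : ρ ⟨x, hxS⟩ - ∑ z : ↥S, K ⟨x, hxS⟩ z * ρ z = ∑ z : ↥S, c z * ρ z := by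
    rw [← hδρ, ← Finset.sum_sub_distrib]
    exact Finset.sum_congr rfl fun z _ => by rw [hc, sub_mul]
  have hw0 : 0 ≤ wt L η j ^ 2 := sq_nonneg _
  have hmaj : ‖∑ z : ↥S, c z • f z.1‖ ≤ ∑ z : ↥S, c z * ρ z := by
    rw [hρ]; exact norm_sum_smul_le_sum_mul_sign _ _ _
  calc wt L η j ^ 2 * ‖(f - P f) x‖ = wt L η j ^ 2 * ‖∑ z : ↥S, c z • f z.1‖ := by rw [hD]
    _ ≤ wt L η j ^ 2 * ∑ z : ↥S, c z * ρ z := mul_le_mul_of_nonneg_left hmaj hw0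
    _ ≤ wt L η j ^ 2 * |ρ ⟨x, hxS⟩ - ∑ z : ↥S, K ⟨x, hxS⟩ z * ρ z| := by
        rw [hφD]; exact mul_le_mul_of_nonneg_left (le_abs_self _) hw0
    _ ≤ BR * r := h

end Rop

#print axioms norm_sum_smul_le_sum_mul_sign
#print axioms hG_flat_of_real
#print axioms hH_flat_of_real
#print axioms hRbd_flat_of_real

end Literature.MathematicalPhysics.QuantumFieldTheory.Balaban1983to89.B8Eq191FlatBoundsTransfer

end
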